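import Summits.QuantumFields.YangMills.Theorems.SwapVirialDeficitBlowUpGnomonicFibreCoercivity
import Summits.QuantumFields.YangMills.Theorems.SwapVirialDeficitBlowUpChartDeficitZeroSet
import HarnessLib

/-!
# W3 clause 2 IN GNOMONIC LETTERS: THE GNOMONIC BASE IS EXACTLY FLAT — `F̂(a, ε, η₀) = 0` at `η₀ = ((x₀e₀, y₀e₀), 0, 0)` for every hub `a ≠ 0`,
# every axial offset `x₀, y₀`, every leader hemisphere pattern with `ε_z = +` and all follower signs `+`; consequences: ray-criticality and the
# UNCONDITIONAL fibre coercivity (free-hands support of ⟨stmt-QuantumFields-24197⟩ `SwapVirialDeficit.SwapGluedStiffness`, principal sector)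

LEAD ym-line-sfw-p2 g97's steep-window Morse–Bott plan, brick W3 second clause «`F̂ = 0` on `{y = 0} × B`»: w3 g65's ✓`chartDeficit_eq_zero_iff` pins the zero set
of the principal chart deficit in `(C, U)` letters (commuting leaders, seam value intertwining the axis swap, followers at `1`); this file reads it in the
GNOMONIC chart ✓`gnoDeficit z χ a ε η = chartDeficit L z χ (blowUpPoint 1 (gnomonicPoint a ε η))`:
* §1 the axial plane `span(1, i) = {q : ℍ | q.imJ = q.imK = 0}` (✓`ZeroModeSigma.axial_comm`, ✓`axisUnit_axial`): `axial_smul`, `axial_radialUnit`,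
  `axial_gnoLetter`, `star_mul_mul_eq_of_axial`; its images in `SU(2)` commute (`su2_mul_comm_of_axial`, via lit ✓`su2Quat_mul` + ✓`su2Quat_injective`);
* §2 the four leaders and the followers of `blowUpPoint 1 (gnomonicPoint a ε η)` read through `su2Quat` at EVERY `η` (`su2Quat_gnoLeader_zero ∕ _one ∕ _two ∕ _three`,
  `gnoFollower_eq`) — the named forms of the local steps of fcl-p3 g47's ✓`contDiff_leader_gnomonic`;
* §3 ★★ `gnoDeficit_base_eq_zero (ha : a ≠ 0) (ε) (hz : ε.2.1 = true) (hF : ε.2.2 = fun _ => true) (x₀ y₀)` — at the base point the letters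
  `±(1, x₀, 0, 0)`, `±(1, y₀, 0, 0)` and the hub unit `ν(axisPoint a) = (re a, ‖im a‖, 0, 0)/‖a‖` all lie in the axial plane, the slaved leader
  `Ā·x̂·A·ẑ` equals `x̂` (`ẑ = 1`), every follower is `1`: the three clauses of ✓`chartDeficit_eq_zero_iff` hold, so `F̂ = 0` — for ALL four leader
  patterns `(ε_x, ε_y) ∈ {±}²` and every hub (no bulk restriction);
* §4 ★ `isMinOn_gnoDeficit_base`, ★ `deriv_gnoDeficit_base_ray_eq_zero (ζ) : deriv (fun s => F̂(η₀ + s•ζ)) 0 = 0`, ★ `fderiv_gnoDeficit_base_eq_zero` — the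
  `hg0`∕`hg1` of w2 g58's ✓`cubicData_of_third` and the `hcrit` of ✓`exists_symmOp_taylor_datum` for the bulk fibre package (w2 g59 D2);
* §5 ★★ `fibre_raySecond_coercive_gnomonic_flat` — w3 g65's ✓`fibre_raySecond_coercive_gnomonic` with `hsmall₁` DISCHARGED and the radius ELIMINATED
  (`R := min 1 √(μ′/(4·63540000L⁴))`): for every hub `a ≠ 0`, every `x₀ y₀` and every `0 < μ′` below the four growth constants,
  `μ′·N(w) ≤ (d²/ds²) F̂(η₀ + s·ξ(w))|₀` for EVERY fibre direction; ★★ `fibre_raySecond_coercive_gnomonic_explicit` — the same with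
  `μ′ = λ(a, x₀, y₀) := min(2s₂ψ²/((2+x₀²)·16200L⁶), 2sψ²/((2+y₀²)·16200L⁶), 1/16200L⁶, (2304L⁶|Fol L|)⁻¹/2)` EXPLICIT in the hub angle
  (`s₂ψ = 2(re a/‖a‖)(‖im a‖/‖a‖)`, `sψ = ‖im a‖/‖a‖`), positive as soon as `re a ≠ 0`, `im a ≠ 0` (LEAD 17:34Z (2): the cut `ψ₀(b)` is chosen later).

HONEST LABEL: algebra on landed results; ⟨24197⟩ (window-uniform) ∕ ⟨24194⟩ ∕ ⟨24497⟩ OPEN; own crux ⟨22884⟩ OPEN (blocked-on ⟨19935⟩); no crux, rung of record or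
summit is proved; the Yang–Mills mass gap is NOT proved; no summit is proved by a line.  THEOREMS ONLY (0 `def`, 0 `sorry`), standard axioms.
Width seat ym-line-sfw-p2-w3 g66 (cell ym-idea-1, free hands), `--supports stmt-QuantumFields-24197`.  References: [cite: tHooft1979]; [cite: Luscher1983, §2]; [folklore].
-/

set_option autoImplicit false

noncomputable section

open MeasureTheory Quaternion
open scoped BigOperators Quaternion ContDiff
open Literature.MathematicalPhysics.QuantumFieldTheory hiding SU2
open Literature.MathematicalPhysics.QuantumLattice
open Literature.Analysis.Calculus (radialUnit radialUnit_def norm_radialUnit)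
open Literature.MathematicalPhysics.QuantumFieldTheory.Balaban1983to89.T4WilsonGaugeFlatDirection (su2Quat_injective)

namespace Summit.QuantumFields.YangMills.Theorems.SwapVirialDeficit.BlowUpRing

open Summit.QuantumFields.YangMills.Theorems.FemtoTransferGap
open Summit.QuantumFields.YangMills.Theorems.FemtoTransferGap.TT
open Summit.QuantumFields.YangMills.Theorems.VirialFluxGap.RingDeficit
open Summit.QuantumFields.YangMills.Theorems.SwapVirialDeficit.SwapRing
open Summit.QuantumFields.YangMills.Theorems.SwapTwistDeficit.ToronLog (axisPoint)
open Summit.QuantumFields.YangMills.Theorems.SwapVirialDeficit.ZeroModeSigma (dil3 dilateIm slaveP slaveP_def norm_slaveP norm_axisUnit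
  su2Quat_quatToSU2_eq_radialUnit axial_comm axisUnit_axial)
open Summit.QuantumFields.YangMills.Theorems.SwapVirialDeficit.BlowUp (leaderTuple leaderTuple_apply dil3_one' dilateIm_one_apply)
open Summit.QuantumFields.YangMills.Theorems.SwapVirialDeficit.Gnomonic (normSq3 su2Quat_quatToSU2_slaveP_mul su2Quat_quatToSU2_axisUnit)

variable {L : ℕ} [NeZero L]

/-! ## §1 The axial plane `span(1, i)` -/

/-- The axial plane `{imJ = imK = 0}` is closed under real scalars. [folklore] -/
theorem axial_smul (c : ℝ) {p : ℍ} (hp : p.imJ = 0 ∧ p.imK = 0) : (c • p).imJ = 0 ∧ (c • p).imK = 0 := by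
  rw [Quaternion.imJ_smul, Quaternion.imK_smul, hp.1, hp.2, smul_zero]; exact ⟨rfl, rfl⟩

/-- The axial plane is closed under radial projection. [folklore] -/
theorem axial_radialUnit {p : ℍ} (hp : p.imJ = 0 ∧ p.imK = 0) : (radialUnit p).imJ = 0 ∧ (radialUnit p).imK = 0 := by
  rw [radialUnit_def]; exact axial_smul _ hp

omit [NeZero L] in
/-- An AXIAL gnomonic letter `±(1, x₀, 0, 0)` lies in the axial plane. [folklore] -/
theorem axial_gnoLetter (ε : Bool) (x₀ : ℝ) : (gnoLetter ε ![x₀, 0, 0]).imJ = 0 ∧ (gnoLetter ε ![x₀, 0, 0]).imK = 0 := by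
  rw [gnoLetter_eq]
  refine axial_smul _ ⟨?_, ?_⟩
  · show (![x₀, 0, 0] : Fin 3 → ℝ) 1 = 0; simp
  · show (![x₀, 0, 0] : Fin 3 → ℝ) 2 = 0; simp

/-- Two `SU(2)` elements whose quaternions are axial COMMUTE (lit ✓`su2Quat_mul`, ✓`su2Quat_injective`). [folklore] -/
theorem su2_mul_comm_of_axial {U V : SU2} (hU : (su2Quat U).imJ = 0 ∧ (su2Quat U).imK = 0) (hV : (su2Quat V).imJ = 0 ∧ (su2Quat V).imK = 0) :
    U * V = V * U :=
  su2Quat_injective (by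
    rw [Balaban1983to89.T4HaarSU2Translate.su2Quat_mul, Balaban1983to89.T4HaarSU2Translate.su2Quat_mul]
    exact axial_comm hU.1 hU.2 hV.1 hV.2)

/-- A unit axial quaternion conjugates an axial quaternion trivially: `Ā·x·A = x`. [folklore] -/
theorem star_mul_mul_eq_of_axial {A x : ℍ} (hA : ‖A‖ = 1) (hAx : A.imJ = 0 ∧ A.imK = 0) (hx : x.imJ = 0 ∧ x.imK = 0) : star A * x * A = x := by
  have hAA : star A * A = 1 := by
    rw [Quaternion.star_mul_self, Quaternion.normSq_eq_norm_mul_self, hA, mul_one, Quaternion.coe_one]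
  rw [mul_assoc, ← axial_comm hAx.1 hAx.2 hx.1 hx.2, ← mul_assoc, hAA, one_mul]

/-! ## §2 The leaders and the followers of a gnomonic chart point, through `su2Quat` -/

omit [NeZero L] in
/-- Leader `C₀ = ν(x)`: `su2Quat C₀ = radialUnit (gnoLetter ε_x η_x)`. [folklore] -/
theorem su2Quat_gnoLeader_zero (a : ℍ) (ε : GnoSign L) (η : GnoCoord L) :
    su2Quat ((blowUpPoint (L := L) 1 (gnomonicPoint a ε η)).1 0) = radialUnit (gnoLetter ε.1.1 η.1.1) := by
  show su2Quat (leaderTuple a (dil3 1 (gnomonicPoint a ε η).2.1) 0) = _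
  rw [(leaderTuple_apply _ _).1, dil3_one']
  exact su2Quat_quatToSU2_eq_radialUnit (gnoLetter_ne_zero _ _)

omit [NeZero L] in
/-- Leader `C₂ = ν(y)`: `su2Quat C₂ = radialUnit (gnoLetter ε_y η_y)`. [folklore] -/
theorem su2Quat_gnoLeader_two (a : ℍ) (ε : GnoSign L) (η : GnoCoord L) :
    su2Quat ((blowUpPoint (L := L) 1 (gnomonicPoint a ε η)).1 2) = radialUnit (gnoLetter ε.1.2 η.1.2) := by
  show su2Quat (leaderTuple a (dil3 1 (gnomonicPoint a ε η).2.1) 2) = _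
  rw [(leaderTuple_apply _ _).2.2.1, dil3_one']
  exact su2Quat_quatToSU2_eq_radialUnit (gnoLetter_ne_zero _ _)

omit [NeZero L] in
/-- Leader `c = C₃ = ν(axisPoint a)` (the hub unit), `a ≠ 0`. [folklore] -/
theorem su2Quat_gnoLeader_three {a : ℍ} (ha : a ≠ 0) (ε : GnoSign L) (η : GnoCoord L) :
    su2Quat ((blowUpPoint (L := L) 1 (gnomonicPoint a ε η)).1 3) = radialUnit (axisPoint a) := by
  show su2Quat (leaderTuple a (dil3 1 (gnomonicPoint a ε η).2.1) 3) = _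
  rw [(leaderTuple_apply _ _).2.2.2]
  exact su2Quat_quatToSU2_axisUnit ha

omit [NeZero L] in
/-- Leader `C₁ = ν(Ā·x̂·A·z)` (the slaved letter): `su2Quat C₁ = Ā · ν(x) · A · ν(z)`, `A = ν(axisPoint a)`, `a ≠ 0`. [folklore] -/
theorem su2Quat_gnoLeader_one {a : ℍ} (ha : a ≠ 0) (ε : GnoSign L) (η : GnoCoord L) :
    su2Quat ((blowUpPoint (L := L) 1 (gnomonicPoint a ε η)).1 1) =
      star (radialUnit (axisPoint a)) * radialUnit (gnoLetter ε.1.1 η.1.1) * radialUnit (axisPoint a) * radialUnit (gnoLetter ε.2.1 η.2.1) := by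
  show su2Quat (leaderTuple a (dil3 1 (gnomonicPoint a ε η).2.1) 1) = _
  rw [(leaderTuple_apply _ _).2.1, dil3_one']
  show su2Quat (quatToSU2 (slaveP (radialUnit (axisPoint a)) (gnoLetter ε.1.1 η.1.1) * gnoLetter ε.2.1 η.2.1)) = _
  rw [su2Quat_quatToSU2_slaveP_mul (norm_axisUnit ha) (gnoLetter_ne_zero _ _) (gnoLetter_ne_zero _ _),
    su2Quat_quatToSU2_eq_radialUnit (gnoLetter_ne_zero _ _), su2Quat_quatToSU2_eq_radialUnit (gnoLetter_ne_zero _ _)]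

omit [NeZero L] in
/-- Follower `U_i = ν(gnoLetter ε_i η_i)`. [folklore] -/
theorem gnoFollower_eq (a : ℍ) (ε : GnoSign L) (η : GnoCoord L) (i : Fol L) :
    (blowUpPoint (L := L) 1 (gnomonicPoint a ε η)).2 i = quatToSU2 (gnoLetter (ε.2.2 i) (η.2.2 i)) := by
  show quatToSU2 (dilateIm 1 (gnoLetter (ε.2.2 i) (η.2.2 i))) = _
  rw [dilateIm_one_apply]

omit [NeZero L] in
/-- The positive letter over the origin is the quaternion `1`: `gnoLetter true 0 = 1`. [folklore] -/
theorem gnoLetter_true_zero : gnoLetter true (0 : Fin 3 → ℝ) = 1 := by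
  rw [gnoLetter_eq]
  have h1 : gnoSign true = 1 := rfl
  rw [h1, one_smul]
  ext <;> simp [gnomonicQuat]

/-- `radialUnit 1 = 1` in `ℍ`. [folklore] -/
theorem radialUnit_one_quat : radialUnit (1 : ℍ) = 1 := by
  rw [radialUnit_def, norm_one, inv_one, one_smul]

/-- `quatToSU2 1 = 1` (read through `su2Quat`). [folklore] -/
theorem quatToSU2_one_eq : quatToSU2 (1 : ℍ) = (1 : SU2) :=
  su2Quat_injective (by rw [su2Quat_quatToSU2_eq_radialUnit one_ne_zero, radialUnit_one_quat, FemtoTransferGap.su2Quat_one])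

/-! ## §3 The gnomonic base is exactly flat -/

/-- ★★ **THE GNOMONIC BASE IS EXACTLY FLAT** (principal sector): for every hub `a ≠ 0`, every sign pattern with `ε_z = +` and all follower signs `+`
(the leader signs `ε_x, ε_y` are free) and every axial offset `x₀, y₀`,
`gnoDeficit 0 1 a ε ((x₀e₀, y₀e₀), 0, 0) = 0`.  The letters `±(1,x₀,0,0)`, `±(1,y₀,0,0)` and the hub unit lie in the commutative axial plane, the slaved
leader `Ā·x̂·A·1̂ = x̂` coincides with `C₀`, every follower is `1` — the three clauses of ✓`chartDeficit_eq_zero_iff`. [cite: tHooft1979] [cite: Luscher1983, §2] -/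
theorem gnoDeficit_base_eq_zero {a : ℍ} (ha : a ≠ 0) (ε : GnoSign L) (hz : ε.2.1 = true) (hF : ε.2.2 = fun _ => true) (x₀ y₀ : ℝ) :
    gnoDeficit (fun _ => false) (fun _ => 1) a ε
      ((((![x₀, 0, 0] : Fin 3 → ℝ), (![y₀, 0, 0] : Fin 3 → ℝ)), ((0 : Fin 3 → ℝ), (0 : Fol L → Fin 3 → ℝ))) : GnoCoord L) = 0 := by
  set η₀ : GnoCoord L := ((((![x₀, 0, 0] : Fin 3 → ℝ), (![y₀, 0, 0] : Fin 3 → ℝ)), ((0 : Fin 3 → ℝ), (0 : Fol L → Fin 3 → ℝ))) : GnoCoord L) with hη₀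
  set q : (Fin 4 → SU2) × (Fol L → SU2) := blowUpPoint (L := L) 1 (gnomonicPoint a ε η₀) with hq
  -- the four leader quaternions
  have hA1 : ‖radialUnit (axisPoint a)‖ = 1 := norm_axisUnit ha
  have h0 : su2Quat (q.1 0) = radialUnit (gnoLetter ε.1.1 ![x₀, 0, 0]) := su2Quat_gnoLeader_zero a ε η₀
  have h2 : su2Quat (q.1 2) = radialUnit (gnoLetter ε.1.2 ![y₀, 0, 0]) := su2Quat_gnoLeader_two a ε η₀
  have h3 : su2Quat (q.1 3) = radialUnit (axisPoint a) := su2Quat_gnoLeader_three ha ε η₀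
  have h1 : su2Quat (q.1 1) = radialUnit (gnoLetter ε.1.1 ![x₀, 0, 0]) := by
    rw [hq, su2Quat_gnoLeader_one ha ε η₀]
    show star (radialUnit (axisPoint a)) * radialUnit (gnoLetter ε.1.1 ![x₀, 0, 0]) * radialUnit (axisPoint a) *
        radialUnit (gnoLetter ε.2.1 (0 : Fin 3 → ℝ)) = _
    rw [hz, gnoLetter_true_zero, radialUnit_one_quat, mul_one]
    exact star_mul_mul_eq_of_axial hA1 (axisUnit_axial a) (axial_radialUnit (axial_gnoLetter _ _))
  -- `C₁ = C₀`, all leaders axial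
  have h10 : q.1 1 = q.1 0 := su2Quat_injective (by rw [h1, h0])
  have hax : ∀ k : Fin 4, (su2Quat (q.1 k)).imJ = 0 ∧ (su2Quat (q.1 k)).imK = 0 := by
    intro k
    fin_cases k
    · show (su2Quat (q.1 0)).imJ = 0 ∧ (su2Quat (q.1 0)).imK = 0
      rw [h0]; exact axial_radialUnit (axial_gnoLetter _ _)
    · show (su2Quat (q.1 1)).imJ = 0 ∧ (su2Quat (q.1 1)).imK = 0
      rw [h1]; exact axial_radialUnit (axial_gnoLetter _ _)
    · show (su2Quat (q.1 2)).imJ = 0 ∧ (su2Quat (q.1 2)).imK = 0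
      rw [h2]; exact axial_radialUnit (axial_gnoLetter _ _)
    · show (su2Quat (q.1 3)).imJ = 0 ∧ (su2Quat (q.1 3)).imK = 0
      rw [h3]; exact axisUnit_axial a
  have hcomm : ∀ k l : Fin 4, q.1 k * q.1 l = q.1 l * q.1 k := fun k l => su2_mul_comm_of_axial (hax k) (hax l)
  unfold gnoDeficit
  rw [← hq, chartDeficit_eq_zero_iff]
  refine ⟨fun μ ν => hcomm _ _, fun μ => ?_, fun i => ?_⟩
  · -- the σ-relations: `C₁ = C₀` and everything commutes
    fin_cases μ
    · show q.1 (Fin.last 3) * q.1 (Fin.castSucc (Equiv.swap (0 : Fin 3) 1 0)) = q.1 (Fin.castSucc 0) * q.1 (Fin.last 3)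
      rw [Equiv.swap_apply_left]
      show q.1 3 * q.1 1 = q.1 0 * q.1 3
      rw [h10]; exact hcomm _ _
    · show q.1 (Fin.last 3) * q.1 (Fin.castSucc (Equiv.swap (0 : Fin 3) 1 1)) = q.1 (Fin.castSucc 1) * q.1 (Fin.last 3)
      rw [Equiv.swap_apply_right]
      show q.1 3 * q.1 0 = q.1 1 * q.1 3
      rw [h10]; exact hcomm _ _
    · show q.1 (Fin.last 3) * q.1 (Fin.castSucc (Equiv.swap (0 : Fin 3) 1 2)) = q.1 (Fin.castSucc 2) * q.1 (Fin.last 3)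
      rw [Equiv.swap_apply_of_ne_of_ne (by decide) (by decide)]
      exact hcomm _ _
  · -- the followers sit at `1`
    rw [hq, gnoFollower_eq, hF]
    show quatToSU2 (gnoLetter true (0 : Fin 3 → ℝ)) = 1
    rw [gnoLetter_true_zero, quatToSU2_one_eq]

/-! ## §4 Consequences: the base point is a global minimum — ray-criticality, vanishing differential -/

/-- ★ **The base point is a global minimum of `F̂ ≥ 0`** (any composition `y ↦ F̂(η₀ + T y)` with `T 0 = 0` is minimal at `y = 0`; `T = id` included). [folklore] -/
theorem isMinOn_gnoDeficit_base_comp {a : ℍ} (ha : a ≠ 0) (ε : GnoSign L) (hz : ε.2.1 = true) (hF : ε.2.2 = fun _ => true) (x₀ y₀ : ℝ)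
    {V : Type*} [Zero V] (T : V → GnoCoord L) (hT : T 0 = 0) :
    IsMinOn (fun y : V => gnoDeficit (fun _ => false) (fun _ => 1) a ε
      (((((![x₀, 0, 0] : Fin 3 → ℝ), (![y₀, 0, 0] : Fin 3 → ℝ)), ((0 : Fin 3 → ℝ), (0 : Fol L → Fin 3 → ℝ))) : GnoCoord L) + T y)) Set.univ 0 := by
  refine isMinOn_iff.2 fun y _ => ?_
  show gnoDeficit (fun _ => false) (fun _ => 1) a ε (_ + T 0) ≤ gnoDeficit (fun _ => false) (fun _ => 1) a ε (_ + T y)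
  rw [hT, add_zero, gnoDeficit_base_eq_zero ha ε hz hF x₀ y₀]
  exact gnoDeficit_nonneg _ _ _ _ _

/-- ★ `F̂(η₀ + T 0) = 0` — the `hg0` of ✓`cubicData_of_third` for the fibre family `g p y := F̂(η₀(p) + T y)`. [folklore] -/
theorem gnoDeficit_base_comp_zero {a : ℍ} (ha : a ≠ 0) (ε : GnoSign L) (hz : ε.2.1 = true) (hF : ε.2.2 = fun _ => true) (x₀ y₀ : ℝ)
    {V : Type*} [Zero V] (T : V → GnoCoord L) (hT : T 0 = 0) :
    gnoDeficit (fun _ => false) (fun _ => 1) a ε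
      (((((![x₀, 0, 0] : Fin 3 → ℝ), (![y₀, 0, 0] : Fin 3 → ℝ)), ((0 : Fin 3 → ℝ), (0 : Fol L → Fin 3 → ℝ))) : GnoCoord L) + T 0) = 0 := by
  rw [hT, add_zero]; exact gnoDeficit_base_eq_zero ha ε hz hF x₀ y₀

/-- ★ **VANISHING DIFFERENTIAL AT THE BASE** — for every map `T` of a real normed space into the gnomonic coordinates with `T 0 = 0`,
`fderiv ℝ (y ↦ F̂(η₀ + T y)) 0 = 0` (a global minimum; no differentiability hypothesis is needed: `fderiv` of a non-differentiable function is `0` too) — the `hg1` of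
✓`cubicData_of_third`. [folklore] -/
theorem fderiv_gnoDeficit_base_comp_eq_zero {a : ℍ} (ha : a ≠ 0) (ε : GnoSign L) (hz : ε.2.1 = true) (hF : ε.2.2 = fun _ => true) (x₀ y₀ : ℝ)
    {V : Type*} [NormedAddCommGroup V] [NormedSpace ℝ V] (T : V → GnoCoord L) (hT : T 0 = 0) :
    fderiv ℝ (fun y : V => gnoDeficit (fun _ => false) (fun _ => 1) a ε
      (((((![x₀, 0, 0] : Fin 3 → ℝ), (![y₀, 0, 0] : Fin 3 → ℝ)), ((0 : Fin 3 → ℝ), (0 : Fol L → Fin 3 → ℝ))) : GnoCoord L) + T y)) 0 = 0 :=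
  ((isMinOn_gnoDeficit_base_comp ha ε hz hF x₀ y₀ T hT).isLocalMin Filter.univ_mem).fderiv_eq_zero

/-- ★ **VANISHING DIFFERENTIAL AT THE BASE**, plain form: `fderiv ℝ F̂ η₀ = 0`. [folklore] -/
theorem fderiv_gnoDeficit_base_eq_zero {a : ℍ} (ha : a ≠ 0) (ε : GnoSign L) (hz : ε.2.1 = true) (hF : ε.2.2 = fun _ => true) (x₀ y₀ : ℝ) :
    fderiv ℝ (gnoDeficit (fun _ => false) (fun _ => 1) a ε)
      ((((![x₀, 0, 0] : Fin 3 → ℝ), (![y₀, 0, 0] : Fin 3 → ℝ)), ((0 : Fin 3 → ℝ), (0 : Fol L → Fin 3 → ℝ))) : GnoCoord L) = 0 := by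
  have h : IsMinOn (gnoDeficit (fun _ => false) (fun _ => 1) a ε) Set.univ
      ((((![x₀, 0, 0] : Fin 3 → ℝ), (![y₀, 0, 0] : Fin 3 → ℝ)), ((0 : Fin 3 → ℝ), (0 : Fol L → Fin 3 → ℝ))) : GnoCoord L) :=
    isMinOn_iff.2 fun η _ => by rw [gnoDeficit_base_eq_zero ha ε hz hF x₀ y₀]; exact gnoDeficit_nonneg _ _ _ _ _
  exact (h.isLocalMin Filter.univ_mem).fderiv_eq_zero

/-- ★ **RAY-CRITICALITY AT THE BASE** — for every direction `ζ`, `(d/ds) F̂(η₀ + s·ζ)|₀ = 0`: the `hcrit` of ✓`exists_symmOp_taylor_datum` ∕ ✓`taylor_datum_of_rays`,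
and the vanishing of the linear term in g47's ✓`taylor_four_gnoDeficit_line` at base points. [folklore] -/
theorem deriv_gnoDeficit_base_ray_eq_zero {a : ℍ} (ha : a ≠ 0) (ε : GnoSign L) (hz : ε.2.1 = true) (hF : ε.2.2 = fun _ => true) (x₀ y₀ : ℝ)
    (ζ : GnoCoord L) :
    deriv (fun s : ℝ => gnoDeficit (fun _ => false) (fun _ => 1) a ε
      (((((![x₀, 0, 0] : Fin 3 → ℝ), (![y₀, 0, 0] : Fin 3 → ℝ)), ((0 : Fin 3 → ℝ), (0 : Fol L → Fin 3 → ℝ))) : GnoCoord L) + s • ζ)) 0 = 0 :=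
  ((isMinOn_gnoDeficit_base_comp ha ε hz hF x₀ y₀ (fun s : ℝ => s • ζ) (zero_smul ℝ ζ)).isLocalMin Filter.univ_mem).deriv_eq_zero

/-! ## §5 The UNCONDITIONAL fibre coercivity at every base point -/

/-- ★★ **THE FULL FIBRE HESSIAN AT EVERY GNOMONIC BASE POINT IS COERCIVE, UNCONDITIONALLY** — w3 g65's ✓`fibre_raySecond_coercive_gnomonic` with the
smallness hypothesis `2·F̂(η₀) ≤ μ′R²/2` DISCHARGED by ✓`gnoDeficit_base_eq_zero` and the radius ELIMINATED (`R := min 1 √(μ′/(4·63540000L⁴))`): for every hub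
`a ≠ 0`, signs with `ε_z = +` and follower signs `+`, every `x₀ y₀`, every `0 < μ′` below the four growth constants and EVERY fibre direction `w = ((u,v),z,η_F)`,
`μ′·(|u|² + |v|² + |z|² + Σ|η_f|²) ≤ (d²/ds²) F̂(η₀ + s·ξ(w))|₀`. [cite: Luscher1983, §2] -/
theorem fibre_raySecond_coercive_gnomonic_flat {a : ℍ} (ha : a ≠ 0) (ε : GnoSign L) (hz : ε.2.1 = true) (hε : ε.2.2 = fun _ => true) (x₀ y₀ : ℝ)
    {μ' : ℝ} (hμ : 0 < μ')
    (hμx : μ' ≤ 2 * (2 * (‖a‖⁻¹ * a.re) * (‖a‖⁻¹ * ‖a.im‖)) ^ 2 / ((2 + x₀ ^ 2) * (16200 * (L : ℝ) ^ 6)))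
    (hμy : μ' ≤ 2 * (‖a‖⁻¹ * ‖a.im‖) ^ 2 / ((2 + y₀ ^ 2) * (16200 * (L : ℝ) ^ 6)))
    (hμz : μ' ≤ 1 / (16200 * (L : ℝ) ^ 6))
    (hμF : μ' ≤ (2304 * (L : ℝ) ^ 6 * (Fintype.card (Fol L) : ℝ))⁻¹ / 2)
    (w : ((Fin 2 → ℝ) × (Fin 2 → ℝ)) × (Fin 3 → ℝ) × (Fol L → Fin 3 → ℝ)) :
    μ' * (w.1.1 0 ^ 2 + w.1.1 1 ^ 2 + (w.1.2 0 ^ 2 + w.1.2 1 ^ 2) + normSq3 w.2.1 + ∑ f, normSq3 (w.2.2 f)) ≤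
      iteratedDeriv 2 (fun s : ℝ => gnoDeficit (fun _ => false) (fun _ => 1) a ε (((((![x₀, 0, 0] : Fin 3 → ℝ), (![y₀, 0, 0] : Fin 3 → ℝ)), ((0 : Fin 3 → ℝ), (0 : Fol L → Fin 3 → ℝ))) : GnoCoord L) + s • (((![0, w.1.1 0, w.1.1 1] : Fin 3 → ℝ), (![0, w.1.2 0, w.1.2 1] : Fin 3 → ℝ)), (w.2.1, w.2.2)))) 0 := by
  have hL : (0 : ℝ) < (L : ℝ) := Nat.cast_pos.2 (Nat.pos_of_ne_zero (NeZero.ne L))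
  have hc : (0 : ℝ) < 4 * (63540000 * (L : ℝ) ^ 4) := by positivity
  set R : ℝ := min 1 (Real.sqrt (μ' / (4 * (63540000 * (L : ℝ) ^ 4)))) with hRdef
  have hR : 0 < R := lt_min one_pos (Real.sqrt_pos.2 (div_pos hμ hc))
  have hR1 : R ≤ 1 := min_le_left _ _
  have hRsq : R ^ 2 ≤ μ' / (4 * (63540000 * (L : ℝ) ^ 4)) := by
    have h1 : R ≤ Real.sqrt (μ' / (4 * (63540000 * (L : ℝ) ^ 4))) := min_le_right _ _
    have h2 : R ^ 2 ≤ Real.sqrt (μ' / (4 * (63540000 * (L : ℝ) ^ 4))) ^ 2 := pow_le_pow_left₀ hR.le h1 2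
    rwa [Real.sq_sqrt (div_pos hμ hc).le] at h2
  have hsmall₁ : 2 * gnoDeficit (fun _ => false) (fun _ => 1) a ε
      ((((![x₀, 0, 0] : Fin 3 → ℝ), (![y₀, 0, 0] : Fin 3 → ℝ)), ((0 : Fin 3 → ℝ), (0 : Fol L → Fin 3 → ℝ))) : GnoCoord L) ≤ μ' * R ^ 2 / 2 := by
    rw [gnoDeficit_base_eq_zero ha ε hz hε x₀ y₀, mul_zero]; positivity
  have hsmall₂ : 2 * (63540000 * (L : ℝ) ^ 4) * R ^ 2 ≤ μ' / 2 := by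
    have h := mul_le_mul_of_nonneg_left hRsq (show (0 : ℝ) ≤ 2 * (63540000 * (L : ℝ) ^ 4) by positivity)
    have e : 2 * (63540000 * (L : ℝ) ^ 4) * (μ' / (4 * (63540000 * (L : ℝ) ^ 4))) = μ' / 2 := by
      field_simp; ring
    rwa [e] at h
  exact fibre_raySecond_coercive_gnomonic ha ε hε x₀ y₀ hR hR1 hμx hμy hμz hμF hsmall₁ hsmall₂ w

/-- ★★ **THE FIBRE COERCIVITY WITH THE CONSTANT EXPLICIT IN THE HUB ANGLE** (LEAD 17:34Z (2): the cut `ψ ≥ ψ₀(b)` is chosen at assembly time): for a hub with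
`re a ≠ 0` and `im a ≠ 0` (i.e. `0 < ψ < π/2`), signs `ε_z = +`, followers `+`, every `x₀ y₀` and every fibre direction,
`λ(a,x₀,y₀)·N(w) ≤ (d²/ds²) F̂(η₀ + s·ξ(w))|₀` with
`λ = min (min (2s₂ψ²/((2+x₀²)·16200L⁶)) (2sψ²/((2+y₀²)·16200L⁶))) (min (1/16200L⁶) ((2304L⁶|Fol L|)⁻¹/2))`, `s₂ψ = 2(re a/‖a‖)(‖im a‖/‖a‖)`, `sψ = ‖im a‖/‖a‖`.
[cite: Luscher1983, §2] -/
theorem fibre_raySecond_coercive_gnomonic_explicit {a : ℍ} (hre : a.re ≠ 0) (him : a.im ≠ 0) (ε : GnoSign L) (hz : ε.2.1 = true)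
    (hε : ε.2.2 = fun _ => true) (x₀ y₀ : ℝ) (w : ((Fin 2 → ℝ) × (Fin 2 → ℝ)) × (Fin 3 → ℝ) × (Fol L → Fin 3 → ℝ)) :
    min (min (2 * (2 * (‖a‖⁻¹ * a.re) * (‖a‖⁻¹ * ‖a.im‖)) ^ 2 / ((2 + x₀ ^ 2) * (16200 * (L : ℝ) ^ 6)))
        (2 * (‖a‖⁻¹ * ‖a.im‖) ^ 2 / ((2 + y₀ ^ 2) * (16200 * (L : ℝ) ^ 6))))
      (min (1 / (16200 * (L : ℝ) ^ 6)) ((2304 * (L : ℝ) ^ 6 * (Fintype.card (Fol L) : ℝ))⁻¹ / 2)) *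
        (w.1.1 0 ^ 2 + w.1.1 1 ^ 2 + (w.1.2 0 ^ 2 + w.1.2 1 ^ 2) + normSq3 w.2.1 + ∑ f, normSq3 (w.2.2 f)) ≤
      iteratedDeriv 2 (fun s : ℝ => gnoDeficit (fun _ => false) (fun _ => 1) a ε (((((![x₀, 0, 0] : Fin 3 → ℝ), (![y₀, 0, 0] : Fin 3 → ℝ)), ((0 : Fin 3 → ℝ), (0 : Fol L → Fin 3 → ℝ))) : GnoCoord L) + s • (((![0, w.1.1 0, w.1.1 1] : Fin 3 → ℝ), (![0, w.1.2 0, w.1.2 1] : Fin 3 → ℝ)), (w.2.1, w.2.2)))) 0 := by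
  have ha : a ≠ 0 := fun h => hre (by rw [h]; rfl)
  have hL : (0 : ℝ) < (L : ℝ) := Nat.cast_pos.2 (Nat.pos_of_ne_zero (NeZero.ne L))
  have hna : 0 < ‖a‖ := norm_pos_iff.2 ha
  have hni : 0 < ‖a.im‖ := norm_pos_iff.2 him
  have hcard : 0 < (Fintype.card (Fol L) : ℝ) := by
    have h1 : 1 ≤ L := Nat.one_le_iff_ne_zero.2 (NeZero.ne L)
    have h4 : 1 ≤ L ^ 4 := Nat.one_le_pow _ _ h1
    have h : 0 < Fintype.card (Fol L) := by rw [card_fol]; omega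
    exact_mod_cast h
  have hs : 0 < ‖a‖⁻¹ * ‖a.im‖ := mul_pos (inv_pos.2 hna) hni
  have hs2 : (2 * (‖a‖⁻¹ * a.re) * (‖a‖⁻¹ * ‖a.im‖)) ^ 2 ≠ 0 := by
    have h1 : 2 * (‖a‖⁻¹ * a.re) * (‖a‖⁻¹ * ‖a.im‖) ≠ 0 :=
      mul_ne_zero (mul_ne_zero two_ne_zero (mul_ne_zero (inv_ne_zero hna.ne') hre)) hs.ne'
    exact pow_ne_zero 2 h1
  have hKx : 0 < 2 * (2 * (‖a‖⁻¹ * a.re) * (‖a‖⁻¹ * ‖a.im‖)) ^ 2 / ((2 + x₀ ^ 2) * (16200 * (L : ℝ) ^ 6)) :=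
    div_pos (mul_pos two_pos (lt_of_le_of_ne (sq_nonneg _) (Ne.symm hs2))) (by positivity)
  have hKy : 0 < 2 * (‖a‖⁻¹ * ‖a.im‖) ^ 2 / ((2 + y₀ ^ 2) * (16200 * (L : ℝ) ^ 6)) := by positivity
  have hKz : 0 < 1 / (16200 * (L : ℝ) ^ 6) := by positivity
  have hKF : 0 < (2304 * (L : ℝ) ^ 6 * (Fintype.card (Fol L) : ℝ))⁻¹ / 2 := by positivity
  refine fibre_raySecond_coercive_gnomonic_flat ha ε hz hε x₀ y₀ (lt_min (lt_min hKx hKy) (lt_min hKz hKF)) ?_ ?_ ?_ ?_ w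
  · exact (min_le_left _ _).trans (min_le_left _ _)
  · exact (min_le_left _ _).trans (min_le_right _ _)
  · exact (min_le_right _ _).trans (min_le_left _ _)
  · exact (min_le_right _ _).trans (min_le_right _ _)

end Summit.QuantumFields.YangMills.Theorems.SwapVirialDeficit.BlowUpRing

end
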